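import Literature.Barriers.Parity.SiegelZeroDichotomyProofs
import Literature.NumberTheory.LFunctions.RHWave0
import HarnessLib

/-!
# `¬ UnboundedSiegelZeros ↔ NoSiegelZeros`

The tree's open statement `Literature.NumberTheory.LFunctions.NoSiegelZeros` (rh.S34: one `c > 0` with
`L(σ, χ) ≠ 0` for `σ > 1 - c/log q`, every `q ≥ 3` and every real primitive `χ mod q`) and the negation of
`Literature.Barriers.Parity.UnboundedSiegelZeros` (bounded quality of Siegel zeros at LARGE conductors) are
EQUIVALENT: `→` is `not_unboundedSiegelZeros_of_noSiegelZeros` (SiegelZeroDichotomy.lean); `←` is proved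
here — at the finitely many small conductors `3 ≤ q < q₀` each of the finitely many `L(s, χ)`, `χ ≠ 1`, is
continuous and non-zero at `s = 1` (`DirichletCharacter.LFunction_ne_zero_of_one_le_re`), hence zero-free on
a real interval `(1 - δ, ∞)`, and the minimum of finitely many positive constants is positive.
-/

noncomputable section

namespace Literature.Barriers.Parity

open Literature.NumberTheory.LFunctions

/-- Finite uniformisation: if each index of a finite set admits a positive `δ` with a property that is
monotone under shrinking `δ`, one positive `δ` serves all indices. [folklore] -/
private theorem exists_pos_forall_mem_finset {ι : Type*} (s : Finset ι) (P : ι → ℝ → Prop)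
    (hmono : ∀ i δ δ', δ' ≤ δ → P i δ → P i δ') (h : ∀ i ∈ s, ∃ δ : ℝ, 0 < δ ∧ P i δ) :
    ∃ δ : ℝ, 0 < δ ∧ ∀ i ∈ s, P i δ := by
  classical
  induction s using Finset.induction_on with
  | empty => exact ⟨1, one_pos, fun i hi => absurd hi (Finset.notMem_empty i)⟩
  | insert a s ha ih =>
    obtain ⟨δ₁, hδ₁, h₁⟩ := h a (Finset.mem_insert_self a s)
    obtain ⟨δ₂, hδ₂, h₂⟩ := ih fun i hi => h i (Finset.mem_insert_of_mem hi)
    refine ⟨min δ₁ δ₂, lt_min hδ₁ hδ₂, fun i hi => ?_⟩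
    rcases Finset.mem_insert.mp hi with rfl | hi
    · exact hmono _ _ _ (min_le_left _ _) h₁
    · exact hmono _ _ _ (min_le_right _ _) (h₂ i hi)

/-- A primitive character of modulus `q ≥ 2` is non-trivial (the trivial character has conductor `1`).
[folklore] -/
private theorem ne_one_of_isPrimitive_of_two_le {q : ℕ} [NeZero q] (hq : 2 ≤ q) {χ : DirichletCharacter ℂ q}
    (hχ : χ.IsPrimitive) : χ ≠ 1 := by
  intro h1
  rw [DirichletCharacter.isPrimitive_def, h1, DirichletCharacter.conductor_one] at hχ
  omega

/-- For a non-trivial Dirichlet character, `L(σ, χ) ≠ 0` on a real neighbourhood `(1 - δ, ∞)` of `σ = 1`: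
continuity at `1` (`differentiableAt_LFunction`) and non-vanishing on `re s ≥ 1`. [folklore] -/
private theorem exists_real_zeroFree_near_one {q : ℕ} [NeZero q] (χ : DirichletCharacter ℂ q)
    (hχ : χ ≠ 1) : ∃ δ : ℝ, 0 < δ ∧ ∀ σ : ℝ, 1 - δ < σ → χ.LFunction σ ≠ 0 := by
  have hcont : ContinuousAt χ.LFunction 1 :=
    (DirichletCharacter.differentiableAt_LFunction χ 1 (Or.inr hχ)).continuousAt
  have hne : χ.LFunction 1 ≠ 0 :=
    DirichletCharacter.LFunction_ne_zero_of_one_le_re χ (Or.inl hχ) (by simp)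
  have hev : ∀ᶠ s in nhds (1 : ℂ), χ.LFunction s ≠ 0 := hcont.eventually_ne hne
  obtain ⟨δ, hδ, hball⟩ := Metric.eventually_nhds_iff.mp hev
  refine ⟨δ, hδ, fun σ hσ => ?_⟩
  rcases le_or_gt 1 σ with h1 | h1
  · exact DirichletCharacter.LFunction_ne_zero_of_one_le_re χ (Or.inl hχ) (by simpa using h1)
  · apply hball
    rw [Complex.dist_eq, show (σ : ℂ) - 1 = ((σ - 1 : ℝ) : ℂ) by push_cast; ring, Complex.norm_real,
      Real.norm_eq_abs, abs_sub_comm, abs_of_pos (by linarith)]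
    linarith

/-- At ONE modulus `q ≥ 2`: a uniform real zero-free interval `(1 - δ, ∞)` for all primitive characters
(finitely many). [folklore] -/
private theorem exists_real_zeroFree_near_one_uniform (q : ℕ) [NeZero q] (hq : 2 ≤ q) :
    ∃ δ : ℝ, 0 < δ ∧ ∀ χ : DirichletCharacter ℂ q, χ.IsPrimitive →
      ∀ σ : ℝ, 1 - δ < σ → χ.LFunction σ ≠ 0 := by
  classical
  obtain ⟨δ, hδ, h⟩ := exists_pos_forall_mem_finset (Finset.univ : Finset (DirichletCharacter ℂ q))
    (fun χ δ => χ.IsPrimitive → ∀ σ : ℝ, 1 - δ < σ → χ.LFunction σ ≠ 0)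
    (fun χ δ δ' hle hP hprim σ hσ => hP hprim σ (by linarith))
    (fun χ _ => by
      by_cases hprim : χ.IsPrimitive
      · obtain ⟨δ, hδ, hz⟩ := exists_real_zeroFree_near_one χ (ne_one_of_isPrimitive_of_two_le hq hprim)
        exact ⟨δ, hδ, fun _ => hz⟩
      · exact ⟨1, one_pos, fun h => absurd h hprim⟩)
  exact ⟨δ, hδ, fun χ hprim => h χ (Finset.mem_univ χ) hprim⟩

/-- **Bounded Siegel-zero quality at large conductors already gives rh.S34.** If `UnboundedSiegelZeros`
fails, then `NoSiegelZeros`: some `c > 0` with `L(σ, χ) ≠ 0` for all `σ > 1 - c/log q`, all `q ≥ 3` and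
all primitive quadratic `χ mod q`.  Large `q`: the zero-free interval `[1 - 1/(η₀ log q), 1)` of
`not_unboundedSiegelZeros_iff_zeroFree` and non-vanishing on `σ ≥ 1`; the finitely many `3 ≤ q < q₀`:
continuity at `σ = 1`. [folklore] -/
theorem noSiegelZeros_of_not_unboundedSiegelZeros (h : ¬ UnboundedSiegelZeros) : NoSiegelZeros := by
  classical
  obtain ⟨η₀, hη₀, q₀, hzf⟩ := not_unboundedSiegelZeros_iff_zeroFree.mp h
  -- small conductors `3 ≤ q < q₀`: one constant `c₁`
  obtain ⟨c₁, hc₁, hsmall⟩ := exists_pos_forall_mem_finset (Finset.Ico 3 q₀)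
    (fun q c => ∀ _ : NeZero q, ∀ χ : DirichletCharacter ℂ q, χ.IsPrimitive →
      ∀ σ : ℝ, 1 - c / Real.log q < σ → χ.LFunction σ ≠ 0)
    (fun q c c' hle hP inst χ hprim σ hσ => by
      have hlog : 0 ≤ Real.log q := Real.log_natCast_nonneg q
      have hdiv : c' / Real.log q ≤ c / Real.log q := div_le_div_of_nonneg_right hle hlog
      exact hP inst χ hprim σ (by linarith))
    (fun q hq => by
      have hq3 : 3 ≤ q := (Finset.mem_Ico.mp hq).1
      haveI : NeZero q := ⟨by omega⟩
      obtain ⟨δ, hδ, hz⟩ := exists_real_zeroFree_near_one_uniform q (by omega)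
      have hlog : 0 < Real.log q := Real.log_pos (by exact_mod_cast (by omega : 1 < q))
      refine ⟨δ * Real.log q, mul_pos hδ hlog, fun inst χ hprim σ hσ => ?_⟩
      have hinst : inst = (⟨by omega⟩ : NeZero q) := Subsingleton.elim _ _
      subst hinst
      refine hz χ hprim σ ?_
      rwa [mul_div_assoc, div_self hlog.ne', mul_one] at hσ)
  refine ⟨min (1 / η₀) c₁, lt_min (by positivity) hc₁, fun q inst hq3 χ hquad hprim σ hσ => ?_⟩
  have hq2 : 2 ≤ q := by omega
  have hχ1 : χ ≠ 1 := ne_one_of_isPrimitive_of_two_le hq2 hprim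
  have hlog : 0 < Real.log q := Real.log_pos (by exact_mod_cast (by omega : 1 < q))
  rcases le_or_gt 1 σ with h1 | h1
  · exact DirichletCharacter.LFunction_ne_zero_of_one_le_re χ (Or.inl hχ1) (by simpa using h1)
  rcases le_or_gt q₀ q with hq₀ | hq₀
  · -- large conductor: the zero-free interval of `¬ UnboundedSiegelZeros`
    refine hzf q χ hq₀ hprim hquad σ ?_ h1
    have hc : min (1 / η₀) c₁ / Real.log q ≤ 1 / (η₀ * Real.log q) := by
      rw [div_le_div_iff₀ hlog (by positivity)]
      have := min_le_left (1 / η₀) c₁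
      have h' : min (1 / η₀) c₁ * (η₀ * Real.log q) ≤ 1 / η₀ * (η₀ * Real.log q) :=
        mul_le_mul_of_nonneg_right this (by positivity)
      calc min (1 / η₀) c₁ * (η₀ * Real.log q) ≤ 1 / η₀ * (η₀ * Real.log q) := h'
        _ = 1 * Real.log q := by field_simp
    linarith
  · -- small conductor
    refine hsmall q (Finset.mem_Ico.mpr ⟨hq3, hq₀⟩) inst χ hprim σ ?_
    have hc : min (1 / η₀) c₁ / Real.log q ≤ c₁ / Real.log q :=
      div_le_div_of_nonneg_right (min_le_right _ _) hlog.le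
    linarith

/-- **`NoSiegelZeros ↔ ¬ UnboundedSiegelZeros`**: rh.S34 is exactly the statement that Siegel zeros have
bounded quality at large conductors. [folklore] -/
theorem noSiegelZeros_iff_not_unboundedSiegelZeros : NoSiegelZeros ↔ ¬ UnboundedSiegelZeros :=
  ⟨not_unboundedSiegelZeros_of_noSiegelZeros, noSiegelZeros_of_not_unboundedSiegelZeros⟩

end Literature.Barriers.Parity

end
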